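import Mathlib
import HarnessLib
import Literature.MathematicalPhysics.QuantumLattice.ScaleZeroMultiplierBandPieces
import Summits.HubbardSuperconductivity.HubbardSuperconductivity.Theorems.KLProgrammeKLRegimeEngineScaleZeroMultiplierCentred

/-!
# (E4)₀, step M6 inputs: the multiplier telescoping over the frame pieces at CENTRED momenta — the partial bands are off the
# scale-`0` shell near the zone boundary (`hvan`), the Leibniz bound for a frame piece times the angular factor (`W`), and the
# padded multiplier as the last telescoped piece

Helper toward `stmt-HubbardSuperconductivity-20236` (`KLRegimeEngineV16`, stub `stub_engine_scale0`, conjunct (E4)₀), item M6 of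
k3c2-p1 g3's T_X plan: the Summits-side telescoping (template `…ScaleZeroE4SpaceMoment`) consumes
`ScaleZeroMultiplierBandPieces.spaceMoment_multBasePiece_le` / `spaceMoment_multIncrPiece_le` piece by piece; the three inputs that
are NOT copies of the covariance template are supplied here:

* **`frameBandInterp_offShell_of_frameOK`** — for the partial bands `bₘ = frameLevel μ 0 − Σ_{n<m} Kₙ` and their interpolations
  `bₘ + s·(−Kₘ)` (`s ∈ [0,1]`, `m ≤ N_sc`): `klE0 < |(bₘ + s(−Kₘ))(p)|` whenever `cos p_l ≤ −cos(4π/L)` for some `l`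
  (`μ ∈ klWindowC`, `(16/15)Gfr0|U| ≤ 1/50`, `2¹⁵ ≤ L`) — the `hvan` hypotheses of the M5 lemmas; `frameLevel_zero_offShell_of_window`
  (the bare band);
* **`norm_iteratedFDeriv_framePiece_mul_le`** — `‖Dⁱ(−Kₘ·Ã)‖ ≤ W_A·Σ_{j≤i} C(i,j)·Gfr j·u_j(U)·4^{(j−2)m}` for any factor with
  `‖DʲÃ‖ ≤ W_A` (`j ≤ i ≤ 3`);
* **`paddedPiece_last_eq_bgmGridSymbol`** — `(βL²)⁻¹·G_ω(q₀,q⃗)` IS the padded piece of the last partial band `b_{N_sc+1} = e_K` times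
  `Ã = zoneAngularRaw 1 (1/4) 0 ω` at the centred momentum (`bgmGridSymbol_eq_centred_piece_of_frameOK`).

Everything is proved; no definitions, no named facts, no sorry. [cite: BenfattoGiulianiMastropietro2006, §2.5 (2.45)–(2.48), §3 (3.2)–(3.8)]
-/

noncomputable section

namespace Summit.HubbardSuperconductivity.HubbardSuperconductivity.Theorems.EngineV8

set_option linter.dupNamespace false -- summit = problem name (single-conjunct summit), D-0017

open Real Finset Literature.MathematicalPhysics.QuantumLattice Literature.Probability.LatticeModels
open Summit.HubbardSuperconductivity.HubbardSuperconductivity.Theorems.KLRegimeSplit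
open Summit.HubbardSuperconductivity.HubbardSuperconductivity.Theorems.KLProgrammeLegKernels
open Summit.HubbardSuperconductivity.HubbardSuperconductivity.Theorems.DispersionFlow
open Summit.HubbardSuperconductivity.HubbardSuperconductivity.Theorems.ScaleZeroDecay

variable {L M N : ℕ}

/-! ### §1 The partial bands are off the shell near the zone boundary -/

section OffShell

variable {R : RenConsts} {U μ : ℝ} {Nsc : ℕ} {Kp : ℕ → TrigPolyC4v}

/-- **The bare band near the zone boundary**: `cos p_l ≤ −c₀` for some `l` gives `frameLevel μ 0 p ≥ 2c₀ − 2 − μ`. -/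
theorem frameLevel_zero_ge_of_cos_le (μ : ℝ) {c₀ : ℝ} (p : Fin 2 → ℝ) (hp : ∃ l : Fin 2, Real.cos (p l) ≤ -c₀) :
    2 * c₀ - 2 - μ ≤ frameLevel μ 0 (WithLp.toLp 2 p) := by
  rw [frameLevel_toLp_eq_ctBandFn, ctBandFn, TrigPolyC4v.eval_zero, sub_zero]
  rcases Fin.exists_fin_two.1 hp with h0 | h1
  · have := Real.cos_le_one (p 1); linarith
  · have := Real.cos_le_one (p 0); linarith

/-- **Partial sums of the pieces of an admissible frame are small**: for `m ≤ N_sc + 1`, `s ∈ [0,1]`,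
`|Σ_{n<m} Kₙ(p) + s·Kₘ(p)| ≤ (16/15)·Gfr0·|U|` (when `m ≤ N_sc`; the piece bounds of `FrameOK`). -/
theorem abs_partialFrame_le (hR : ∀ j, 0 ≤ R.Gfr j)
    (hS : ∀ n ≤ Nsc, ∀ j ≤ 4, ∀ q : Momentum, ‖iteratedFDeriv ℝ j (evalM (Kp n)) q‖ ≤ R.Gfr j * uPow j U * (4 : ℝ) ^ (((j : ℤ) - 2) * n))
    {m : ℕ} (hm : m ≤ Nsc) {s : ℝ} (hs : s ∈ Set.Icc (0 : ℝ) 1) (q : Momentum) :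
    |∑ n ∈ range m, evalM (Kp n) q + s * evalM (Kp m) q| ≤ 16 / 15 * (R.Gfr 0 * |U|) := by
  have hpiece : ∀ n ≤ Nsc, |evalM (Kp n) q| ≤ R.Gfr 0 * uPow 0 U * (4 : ℝ) ^ (((0 : ℤ) - 2) * n) := fun n hn => by
    have h := hS n hn 0 (by norm_num) q
    rwa [norm_iteratedFDeriv_zero, Real.norm_eq_abs] at h
  have hnn : ∀ n, 0 ≤ R.Gfr 0 * uPow 0 U * (4 : ℝ) ^ (((0 : ℤ) - 2) * n) := fun n => by
    have : 0 ≤ uPow 0 U := by unfold uPow; split_ifs <;> positivity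
    have := hR 0
    positivity
  calc |∑ n ∈ range m, evalM (Kp n) q + s * evalM (Kp m) q|
      ≤ ∑ n ∈ range m, |evalM (Kp n) q| + |s| * |evalM (Kp m) q| := by
        refine (abs_add_le _ _).trans (add_le_add (abs_sum_le_sum_abs _ _) ?_)
        rw [abs_mul]
    _ ≤ ∑ n ∈ range m, R.Gfr 0 * uPow 0 U * (4 : ℝ) ^ (((0 : ℤ) - 2) * n) + 1 * (R.Gfr 0 * uPow 0 U * (4 : ℝ) ^ (((0 : ℤ) - 2) * m)) := by
        refine add_le_add (sum_le_sum fun n hn => hpiece n ((Nat.lt_succ_iff.1 (by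
          have := mem_range.1 hn; omega)).trans hm)) ?_
        have hs1 : |s| ≤ 1 := by rw [abs_of_nonneg hs.1]; exact hs.2
        exact mul_le_mul hs1 (hpiece m hm) (abs_nonneg _) zero_le_one
    _ = ∑ n ∈ range (m + 1), R.Gfr 0 * uPow 0 U * (4 : ℝ) ^ (((0 : ℤ) - 2) * n) := by rw [sum_range_succ, one_mul]
    _ ≤ ∑ n ∈ range (Nsc + 1), R.Gfr 0 * uPow 0 U * (4 : ℝ) ^ (((0 : ℤ) - 2) * n) :=
        sum_le_sum_of_subset_of_nonneg (range_subset_range.2 (by omega)) fun n _ _ => hnn n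
    _ ≤ 16 / 15 * (R.Gfr 0 * |U|) := allowanceSum_zero_le hR U Nsc

/-- **The interpolated partial bands are off the scale-`0` shell near the zone boundary** (`hvan` of the M5 lemmas): under the
piece bounds of `FrameOK`, `μ ∈ klWindowC`, `(16/15)Gfr0|U| ≤ 1/50`, `2¹⁵ ≤ L`, for `m ≤ N_sc`, `s ∈ [0,1]` and every `p` with
`cos p_l ≤ −cos(4π/L)` for some `l`: `klE0 < |(bₘ + s·(−Kₘ))(p)|`. -/
theorem frameBandInterp_offShell_of_frameOK (hR : ∀ j, 0 ≤ R.Gfr j)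
    (hS : ∀ n ≤ Nsc, ∀ j ≤ 4, ∀ q : Momentum, ‖iteratedFDeriv ℝ j (evalM (Kp n)) q‖ ≤ R.Gfr j * uPow j U * (4 : ℝ) ^ (((j : ℤ) - 2) * n))
    (hμ : μ ∈ klWindowC) (hκU : 16 / 15 * (R.Gfr 0 * |U|) ≤ 1 / 50) (hL : (2 : ℝ) ^ 15 ≤ L) {m : ℕ} (hm : m ≤ Nsc)
    {s : ℝ} (hs : s ∈ Set.Icc (0 : ℝ) 1) (p : Fin 2 → ℝ) (hp : ∃ l : Fin 2, Real.cos (p l) ≤ -Real.cos (4 * Real.pi / L)) :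
    klE0 < |(frameLevel μ 0 (WithLp.toLp 2 p) - ∑ n ∈ range m, evalM (Kp n) (WithLp.toLp 2 p)) +
      s * -evalM (Kp m) (WithLp.toLp 2 p)| := by
  obtain ⟨hμ1, hμ2⟩ := hμ
  have hband := frameLevel_zero_ge_of_cos_le μ p hp
  have hpart := abs_partialFrame_le hR hS hm hs (WithLp.toLp 2 p)
  have hpart' := (abs_le.1 hpart).2
  -- `2cos(4π/L) − 2 ≥ −(4π/L)² ≥ −2^{-22}·…`
  have hLpos : (0 : ℝ) < L := lt_of_lt_of_le (by norm_num) hL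
  have h4πL : 4 * Real.pi / L ≤ 1 / 2 ^ 11 := by
    rw [div_le_iff₀ hLpos]
    have : (4 : ℝ) * Real.pi ≤ 2 ^ 4 := by linarith [Real.pi_lt_four]
    calc 4 * Real.pi ≤ 2 ^ 4 := this
      _ = 1 / 2 ^ 11 * 2 ^ 15 := by norm_num
      _ ≤ 1 / 2 ^ 11 * L := by gcongr
  have hcos : 1 - (4 * Real.pi / L) ^ 2 / 2 ≤ Real.cos (4 * Real.pi / L) := Real.one_sub_sq_div_two_le_cos
  have hsmall : (4 * Real.pi / L) ^ 2 ≤ (1 / 2 ^ 11) ^ 2 := pow_le_pow_left₀ (by positivity) h4πL 2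
  refine lt_of_lt_of_le ?_ (le_abs_self _)
  rw [klE0]
  norm_num at hsmall ⊢
  nlinarith [hcos, hsmall, hμ2, hκU, hband, hpart']

/-- **The bare band is off the shell near the zone boundary** (`m = 0`, `s = 0` of the previous lemma, stated without pieces):
`klE0 < |frameLevel μ 0 p|` for `μ ∈ klWindowC`, `2¹⁵ ≤ L`, `cos p_l ≤ −cos(4π/L)`. -/
theorem frameLevel_zero_offShell_of_window (hμ : μ ∈ klWindowC) (hL : (2 : ℝ) ^ 15 ≤ L) (p : Fin 2 → ℝ)
    (hp : ∃ l : Fin 2, Real.cos (p l) ≤ -Real.cos (4 * Real.pi / L)) : klE0 < |frameLevel μ 0 (WithLp.toLp 2 p)| := by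
  obtain ⟨hμ1, hμ2⟩ := hμ
  have hband := frameLevel_zero_ge_of_cos_le μ p hp
  have hLpos : (0 : ℝ) < L := lt_of_lt_of_le (by norm_num) hL
  have h4πL : 4 * Real.pi / L ≤ 1 / 2 ^ 11 := by
    rw [div_le_iff₀ hLpos]
    have : (4 : ℝ) * Real.pi ≤ 2 ^ 4 := by linarith [Real.pi_lt_four]
    calc 4 * Real.pi ≤ 2 ^ 4 := this
      _ = 1 / 2 ^ 11 * 2 ^ 15 := by norm_num
      _ ≤ 1 / 2 ^ 11 * L := by gcongr
  have hcos : 1 - (4 * Real.pi / L) ^ 2 / 2 ≤ Real.cos (4 * Real.pi / L) := Real.one_sub_sq_div_two_le_cos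
  have hsmall : (4 * Real.pi / L) ^ 2 ≤ (1 / 2 ^ 11) ^ 2 := pow_le_pow_left₀ (by positivity) h4πL 2
  refine lt_of_lt_of_le ?_ (le_abs_self _)
  rw [klE0]
  norm_num at hsmall ⊢
  nlinarith [hcos, hsmall, hμ2, hband]

end OffShell

/-! ### §2 A frame piece times the angular factor: the Leibniz bound -/

/-- **`‖Dⁱ(−Kₘ·Ã)(x)‖ ≤ W_A·Σ_{j≤i} C(i,j)·Gfr j·u_j(U)·4^{(j−2)m}`** for `i ≤ 3`, any smooth real factor `Ã` with `‖DʲÃ‖ ≤ W_A`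
(`j ≤ 3`) and the piece bounds of `FrameOK` (`m ≤ N_sc`). -/
theorem norm_iteratedFDeriv_framePiece_mul_le {R : RenConsts} {U : ℝ} {Nsc : ℕ} {Kp : ℕ → TrigPolyC4v}
    (hS : ∀ n ≤ Nsc, ∀ j ≤ 4, ∀ q : Momentum, ‖iteratedFDeriv ℝ j (evalM (Kp n)) q‖ ≤ R.Gfr j * uPow j U * (4 : ℝ) ^ (((j : ℤ) - 2) * n))
    {m : ℕ} (hm : m ≤ Nsc) {A : EuclideanSpace ℝ (Fin 2) → ℝ} (hA : ContDiff ℝ 3 A) {WA : ℝ}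
    (hWA : ∀ j ≤ 3, ∀ x, ‖iteratedFDeriv ℝ j A x‖ ≤ WA) {i : ℕ} (hi : i ≤ 3) (x : EuclideanSpace ℝ (Fin 2)) :
    ‖iteratedFDeriv ℝ i (fun x => -evalM (Kp m) x * A x) x‖ ≤
      WA * ∑ j ∈ Finset.range (i + 1), (i.choose j : ℝ) * (R.Gfr j * uPow j U * (4 : ℝ) ^ (((j : ℤ) - 2) * m)) := by
  have hWA0 : 0 ≤ WA := (norm_nonneg _).trans (hWA 0 (by norm_num) x)
  have hf : ContDiff ℝ i (fun x : EuclideanSpace ℝ (Fin 2) => -evalM (Kp m) x) := (contDiff_evalM (Kp m)).neg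
  have hg : ContDiff ℝ i A := hA.of_le (by exact_mod_cast hi)
  have hL := norm_iteratedFDeriv_mul_le (N := (i : ℕ∞)) hf hg x (n := i) le_rfl
  refine hL.trans ?_
  rw [mul_sum]
  refine sum_le_sum fun j hj => ?_
  have hji : j ≤ i := Nat.lt_succ_iff.1 (mem_range.1 hj)
  have h1 : ‖iteratedFDeriv ℝ j (fun x : EuclideanSpace ℝ (Fin 2) => -evalM (Kp m) x) x‖ ≤
      R.Gfr j * uPow j U * (4 : ℝ) ^ (((j : ℤ) - 2) * m) := by
    rw [show (fun x : EuclideanSpace ℝ (Fin 2) => -evalM (Kp m) x) = -evalM (Kp m) from rfl, iteratedFDeriv_neg_apply, norm_neg]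
    exact hS m hm j (by omega) x
  have h2 := hWA (i - j) (by omega) x
  have h10 : 0 ≤ R.Gfr j * uPow j U * (4 : ℝ) ^ (((j : ℤ) - 2) * m) := (norm_nonneg _).trans h1
  calc (i.choose j : ℝ) * ‖iteratedFDeriv ℝ j (fun x : EuclideanSpace ℝ (Fin 2) => -evalM (Kp m) x) x‖ *
        ‖iteratedFDeriv ℝ (i - j) A x‖
      ≤ (i.choose j : ℝ) * (R.Gfr j * uPow j U * (4 : ℝ) ^ (((j : ℤ) - 2) * m)) * WA :=
        mul_le_mul (mul_le_mul_of_nonneg_left h1 (Nat.cast_nonneg _)) h2 (norm_nonneg _) (by positivity)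
    _ = WA * ((i.choose j : ℝ) * (R.Gfr j * uPow j U * (4 : ℝ) ^ (((j : ℤ) - 2) * m))) := by ring

/-! ### §3 The padded multiplier is the last telescoped piece -/

/-- **The normalised padded multiplier as a padded piece of the last partial band**: under `FrameOK R U N_sc μ K` with pieces
`Kp` (`K = Σ_{n≤N_sc} Kₙ`), `μ ∈ klWindowC`, `(16/15)Gfr0|U| ≤ 1/50`, `β ≠ 0`, `L ≠ 0`,
`(βL²)⁻¹·G_ω(q₀,q⃗) = paddedPiece L M N β (ω ↦ y ↦ βL²·(M_ℂ(ω, b_{N_sc+1}(c⃗(y))))·Ã_ω(c⃗(y))) q₀ q⃗` with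
`b_{N_sc+1} = frameLevel μ 0 − Σ_{n≤N_sc} evalM (Kp n)` and `Ã_ω = zoneAngularRaw 1 (1/4) 0 ω`. -/
theorem paddedPiece_last_eq_bgmGridSymbol [NeZero L] {R : RenConsts} {U μ β : ℝ} {Nsc : ℕ} {K : TrigPolyC4v} {Kp : ℕ → TrigPolyC4v}
    (hK : FrameOK R U Nsc μ K) (hR : ∀ j, 0 ≤ R.Gfr j)
    (hsum : ∀ p : Fin 2 → ℝ, K.eval p = ∑ n ∈ range (Nsc + 1), (Kp n).eval p)
    (hμ : μ ∈ klWindowC) (hκU : 16 / 15 * (R.Gfr 0 * |U|) ≤ 1 / 50) (hβ : β ≠ 0) (ω : Fin (sectorCount 0))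
    (q₀ : TorusSite 1 N) (qv : TorusSite 2 L) :
    (((1 / (β * (L : ℝ) ^ 2) : ℝ)) : ℂ) * bgmGridSymbol L M N klE0 β μ K ω q₀ qv =
      paddedPiece L M N β (fun ω' y => ((β * (L : ℝ) ^ 2 : ℝ) : ℂ) *
        (((bgmCutoff₂ klE0 (fbPt ω' ((fun q : EuclideanSpace ℝ (Fin 2) =>
            frameLevel μ 0 q - ∑ n ∈ range (Nsc + 1), evalM (Kp n) q) (WithLp.toLp 2 (torusCentredMomentum L y)))) : ℝ) : ℂ) *
          ((zoneAngularRaw 1 (1 / 4) 0 ((ω : ℕ) : ℤ) (WithLp.toLp 2 (torusCentredMomentum L y)) : ℝ) : ℂ))) q₀ qv := by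
  have hL : (L : ℝ) ≠ 0 := by exact_mod_cast NeZero.ne L
  rw [bgmGridSymbol_eq_centred_piece_of_frameOK hK hR hμ hκU β ω q₀ qv, paddedPiece_apply]
  simp only [frameBandSeq_last_eq_frameLevel μ hsum]
  split_ifs with h
  · have hβL : ((β * (L : ℝ) ^ 2 : ℝ) : ℂ) ≠ 0 := by exact_mod_cast mul_ne_zero hβ (pow_ne_zero 2 hL)
    push_cast
    field_simp
  · simp

end Summit.HubbardSuperconductivity.HubbardSuperconductivity.Theorems.EngineV8
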